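import Summits.ResolutionOfSingularities.ResolutionOfSingularities.Theorems.FrobeniusClosingPatchingRelPerfectCoreRungSquarePlusLinearCharts
import HarnessLib

/-!
# Crux `PatchingRelPerfect` (stmt-ResolutionOfSingularities-16161), chain w52 — shared tool for the
# CORE RUNGS: chartwise assembly over the Rees charts of a first blow-up

[OURS · L1 W5.2 · rung tool] CHAIN.md v1.1 §2 (row stub-4) asks for the chartwise assembly lemma
of rung r1c as a separate helper, for reuse by rungs r1d / r1e (companion searches on explicit
ideals of `κ[[x₁,…,x₄]]`).  Setting: ANY commutative ring `R`, a finite family `x : Fin n → R`,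
`M = (x₁, …, x_n)`, `B = Bl_M Spec R = Proj R[Mt]` (`affineBlowup M`) with its Rees charts
`D₊(x_i t) = Spec B_i`, `B_i = (R[Mt])_{(x_i t)}` (`chartRing x i`, structure map `chartBase x i`,
generators `chartGen x i j = x_j/x_i`; `BlowupChartRsop.lean`), and ANY ideal `J ⊆ R`.  PROVED:

* `isRegular_of_isBlowup_comap_affineBlowup_of_charts` — if for every `i` every blow-up of the
  chart `Spec B_i` along `J · B_i` is regular, then every blow-up of `B` along the total transform
  `J · 𝒪_B` is regular (the flat pullbacks of such a blow-up to the charts are blow-ups of the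
  charts, GW Prop. 13.91 (2) `IsBlowup.pullback_snd_of_flat`, and the charts cover `B`);
* `isRegular_of_isBlowup_mul_of_charts` — hence every blow-up of `Spec R` along `J · M` is regular
  (Stacks 080A: `Bl_{J·M} = Bl_{J·𝒪_B} B`);
* `atomConclusion_of_pointBlowup_charts` — **companion form over a regular local base**: for
  `S` regular local with minimal basis `x` of `𝔪 ≠ 0`, `I ≠ 0`, a candidate `Q₀ ⊇ 𝔪ᴺ`, if every
  blow-up of every Rees chart of `Bl_𝔪 Spec S` along `(I·Q₀) · B_i` is regular, then every
  blow-up `T = Bl_I Spec S` satisfies the conclusion of the blow-up-form core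
  (`AtomDimFourBlowupAt`-shape) with companion `Q = Q₀ · 𝔪` (W2,
  `atomConclusion_of_companion_regularLocal`).  So a rung "by one point blow-up" reduces to `n`
  chart statements about explicit ideals of the polynomial-like rings `B_i`
  (`B_i ⧸ (x_i) ≅ κ[T_j : j ≠ i]`, `chartQuotEquiv`).

No hypothesis on `R` in the first two statements (no Noetherianity, no regularity); rung r1c
(`…CoreRungSquarePlusLinear.lean`) is the instance `J = 𝔪² + (z)`, `Q₀ = 1`.  Nothing here is a
statement of the manuscript under review.

## References

* U. Görtz, T. Wedhorn, *Algebraic Geometry I* (2nd ed., 2020), Prop. 13.91 (2). [GortzWedhorn2020]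
* The Stacks Project, Tags 080A, 0804. [StacksProject]
-/

-- `Summit.<Summit>.<Sub>.Theorems` with `Sub = Summit` (single-conjunct summit, D-0017)
set_option linter.dupNamespace false

noncomputable section

open CategoryTheory CategoryTheory.Limits AlgebraicGeometry Literature.AlgebraicGeometry.Resolution

namespace Summit.ResolutionOfSingularities.ResolutionOfSingularities.Theorems

universe u

section AnyRing

variable {R : Type u} [CommRing R] {n : ℕ} (x : Fin n → R) (J : Ideal R)

/-- **Chartwise assembly.** If every blow-up of every Rees chart `Spec B_i` of
`B = Bl_{(x)} Spec R` along `J · B_i` is regular, then every blow-up of `B` along the total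
transform `J · 𝒪_B` is regular: its flat pullback to the chart `D₊(x_i t)` is a blow-up of the
chart along `J · B_i` (blow-ups commute with flat base change), and the charts cover `B`.
[cite: GortzWedhorn2020, Prop. 13.91 (2)] -/
theorem isRegular_of_isBlowup_comap_affineBlowup_of_charts
    (hcharts : ∀ (i : Fin n) (Y : Scheme.{u}) (ρ : Y ⟶ Spec (.of (chartRing x i))),
      IsBlowup ρ (affineBlowup.idealSheaf (J.map (chartBase x i))) → Scheme.IsRegular Y)
    {Y : Scheme.{u}} {ρ : Y ⟶ affineBlowup (Ideal.span (Set.range x))}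
    (hρ : IsBlowup ρ ((affineBlowup.idealSheaf J).comap
      (affineBlowup.π (Ideal.span (Set.range x))))) :
    Scheme.IsRegular Y := by
  refine Scheme.IsRegular.of_forall_exists_isOpenImmersion fun y => ?_
  have hp : ρ.base y ∈ (⨆ i : Fin n, Proj.basicOpen (reesGrading (Ideal.span (Set.range x)))
      (reesT (x i) (Ideal.mem_span_range_self (f := x) (x := i)))) := by
    rw [affineBlowup.iSup_basicOpen_reesT_generators_eq_top x]; trivial
  obtain ⟨i, hi⟩ := TopologicalSpace.Opens.mem_iSup.mp hp
  have hb : x i ∈ Ideal.span (Set.range x) := Ideal.mem_span_range_self (f := x) (x := i)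
  have hrange : ρ.base y ∈ Set.range
      (affineBlowup.chartι (I := Ideal.span (Set.range x)) (x i) hb).base := by
    rw [← Scheme.Hom.coe_opensRange, ← Scheme.Hom.image_top_eq_opensRange,
      affineBlowup.image_top_chartι]
    exact hi
  have hsnd : IsBlowup (pullback.snd ρ (affineBlowup.chartι (I := Ideal.span (Set.range x)) (x i) hb))
      (affineBlowup.idealSheaf (J.map (chartBase x i))) := by
    have h := hρ.pullback_snd_of_flat (affineBlowup.chartι (I := Ideal.span (Set.range x)) (x i) hb)
    rwa [← Scheme.IdealSheafData.comap_comp, affineBlowup.chartι_π,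
      affineBlowup.comap_idealSheaf_specMap] at h
  have hreg := hcharts i _ _ hsnd
  refine ⟨_, pullback.fst ρ (affineBlowup.chartι (I := Ideal.span (Set.range x)) (x i) hb),
    inferInstance, ?_, hreg⟩
  rw [Scheme.Pullback.range_fst]
  exact hrange

/-- **Hence every blow-up of `Spec R` along `J · (x)` is regular** under the same chart
hypotheses (Stacks 080A: `Bl_{J·M} Spec R ≅ Bl_{J·𝒪_B} B`, `B = Bl_M Spec R`).
[cite: StacksProject, Tag 080A] -/
theorem isRegular_of_isBlowup_mul_of_charts
    (hcharts : ∀ (i : Fin n) (Y : Scheme.{u}) (ρ : Y ⟶ Spec (.of (chartRing x i))),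
      IsBlowup ρ (affineBlowup.idealSheaf (J.map (chartBase x i))) → Scheme.IsRegular Y)
    {Y : Scheme.{u}} {σ : Y ⟶ Spec (.of R)}
    (hσ : IsBlowup σ (affineBlowup.idealSheaf (J * Ideal.span (Set.range x)))) :
    Scheme.IsRegular Y := by
  obtain ⟨Y₁, ρ, hρ⟩ := exists_isBlowup (affineBlowup (Ideal.span (Set.range x)))
    ((affineBlowup.idealSheaf J).comap (affineBlowup.π (Ideal.span (Set.range x))))
  have h1 : IsBlowup (ρ ≫ affineBlowup.π (Ideal.span (Set.range x)))
      (affineBlowup.idealSheaf (J * Ideal.span (Set.range x))) := by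
    rw [mul_comm, affineBlowup.idealSheaf_mul]
    exact (affineBlowup.isBlowup (Ideal.span (Set.range x))).comp hρ
  obtain ⟨e, -, -⟩ := hσ.unique h1
  exact SectionAscent.TraceIdeal.isRegular_of_iso e
    (isRegular_of_isBlowup_comap_affineBlowup_of_charts x J hcharts hρ)

end AnyRing

/-- **Companion form over a regular local base (the `AtomDimFourBlowupAt` shape).** Let `S` be
regular local with `𝔪 = (x₁, …, x_n) ≠ 0`, `I ≠ 0`, and `Q₀ ⊇ 𝔪ᴺ` a candidate. If every blow-up
of every Rees chart `Spec B_i` of `Bl_𝔪 Spec S` along `(I · Q₀) · B_i` is regular, then for every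
blow-up `f : T ⟶ Spec S` along `I` there is a non-zero ideal sheaf `J` on `T`, cosupported in the
closed fibre, with regular blowing up — the companion `Q = Q₀ · 𝔪` of W2
(`atomConclusion_of_companion_regularLocal`; `Bl_{I·Q₀·𝔪}` is regular by the chartwise assembly).
[cite: StacksProject, Tag 080A] [cite: GortzWedhorn2020, Prop. 13.91 (2)] -/
theorem atomConclusion_of_pointBlowup_charts {S : Type u} [CommRing S] [IsRegularLocalRing S]
    {n : ℕ} (x : Fin n → S) (hx : Ideal.span (Set.range x) = IsLocalRing.maximalIdeal S)
    (h𝔪 : IsLocalRing.maximalIdeal S ≠ ⊥) {I Q₀ : Ideal S} (hI : I ≠ ⊥) {N : ℕ}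
    (hQ₀ : IsLocalRing.maximalIdeal S ^ N ≤ Q₀)
    (hcharts : ∀ (i : Fin n) (Y : Scheme.{u}) (ρ : Y ⟶ Spec (.of (chartRing x i))),
      IsBlowup ρ (affineBlowup.idealSheaf ((I * Q₀).map (chartBase x i))) → Scheme.IsRegular Y)
    (T : Scheme.{u}) (f : T ⟶ Spec (.of S)) (hf : IsBlowup f (affineBlowup.idealSheaf I)) :
    ∃ (J : T.IdealSheafData) (T' : Scheme.{u}) (π : T' ⟶ T), J ≠ ⊥ ∧
      (∀ t : T, t ∈ J.support → f.base t = IsLocalRing.closedPoint S) ∧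
      IsBlowup π J ∧ Scheme.IsRegular T' := by
  haveI : IsDomain S := isDomain_of_isRegularLocalRing S
  -- `Bl_{I·Q₀·𝔪}` is regular
  obtain ⟨Y, σ, hσ⟩ := exists_isBlowup (Spec (.of S))
    (affineBlowup.idealSheaf ((I * Q₀) * Ideal.span (Set.range x)))
  have hY := isRegular_of_isBlowup_mul_of_charts x (I * Q₀) hcharts hσ
  rw [mul_assoc, affineBlowup.idealSheaf_mul] at hσ
  -- the companion `Q = Q₀ · 𝔪 ⊇ 𝔪ᴺ⁺¹` is non-zero and cosupported at the closed point
  have hpow : IsLocalRing.maximalIdeal S ^ (N + 1) ≤ Q₀ * Ideal.span (Set.range x) := by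
    rw [pow_succ, hx]
    exact Ideal.mul_mono_left hQ₀
  have hQne : Q₀ * Ideal.span (Set.range x) ≠ ⊥ := fun h =>
    pow_ne_zero (N + 1) h𝔪 (eq_bot_iff.mpr (hpow.trans h.le))
  exact atomConclusion_of_companion_regularLocal hf (affineBlowup.idealSheaf_ne_bot hI)
    (affineBlowup.idealSheaf_ne_bot hQne) (support_idealSheaf_subset_closedPoint hpow) hσ hY

end Summit.ResolutionOfSingularities.ResolutionOfSingularities.Theorems

end
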